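import Summits.BirchSwinnertonDyer.BirchSwinnertonDyer.Theorems.ErratumRoadFiveKatoFframeFineDescentRankOne
import Literature.NumberTheory.EllipticCurves.IwasawaEulerCharProofs
import Literature.NumberTheory.EllipticCurves.IwasawaAlgebraSpecializationTorsionCountProofs
import HarnessLib

/-!
# Route `ErratumRoadFive`, crux 19715 `EulerHalfNotRamNoInertSetAtFive`, line `kato_Fframe` (r5.2), stub S1Λ
# `stub_katoLambdaLogBoundTamagawa` — HELPER (stage 1, from P1 onward): Kato's §14.14 count
# `#H²(ℤ[1/p], T_pW) ∣ [H¹(ℤ[1/p], T_pW) : ℤ_p s₀]` in RANK ONE, in the tree's currency `#(𝐇²_Γ)_Γ ∣ [A : ℤ_p s₀]`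
# (Herbrand transfer of P1 along `X₀(W/ℚ_∞) ↪ 𝐇²_Γ` with finite cokernel)

Seat `bsd-idea-9` (planner/ideator, g40), `--supports stmt-BirchSwinnertonDyer-19715` as HELPER; W-79: no registration touched;
theorems only (0 defs, 0 named facts, 0 sorry); nothing here closes 19715 or any registered stub; no summit statement / BSD / KMC is
proved. Pen decision bsd-stepL g48 2026-08-30T05:22:22Z («S1Λ stage 1 FROM P1 ONWARD: … the Λ-IV level-0 control count»).

WHY. P1 (`ErratumRoadFiveKatoFframeFineDescentRankOne`, p762750) descends `char_Λ(𝐇¹_Γ/Λs) ⊆ char_Λ X₀(W/ℚ_∞)` to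
`#Sel₀(W/ℚ_∞)^Γ · #𝐇²_Γ[T] ∣ #Sel₀(W/ℚ_∞)_Γ · [A : ℤ_p s₀]` (`A = H¹(ℤ[1/p], T_pW) = integralH1 …`, `s₀ = proj₀ s`), and P1′ keeps only
`#Sel₀(W/ℚ_∞)^Γ ∣ [A : ℤ_p s₀]`. For the LEVEL-0 COUNT of S1Λ the right left-hand side is not `#X₀(ℚ_∞)_Γ = #Sel₀(W/ℚ_∞)^Γ` but
`#(𝐇²_Γ)_Γ = #H²(ℤ[1/p], T_pW)` ([Ka] (14.14.2), p. 243), which (14.9.3) (p. 240) then expresses through `#Sel_str(ℚ, W[p^∞])`,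
`#W(ℚ_p)[p^∞]` and `#W(ℚ)[p^∞]` (tree: `Kato2004.KatoH2CountAt`, `StrictSelmerH2Count.lean`); the two differ by the Herbrand quotient of
the finite cokernel of `X₀ ↪ 𝐇²_Γ` (`⊆ (W(ℚ_{p,∞})[p^∞])^∨`, H2X′), which is `1` — so nothing is lost, but the transfer must be made.
This file makes it: [Ka] §14.14 display (p. 243) «`#(𝐇²(T)/a𝐇²(T)) · #(ₐ𝐇²(T))⁻¹ ≤ [𝐇¹(T)/a𝐇¹(T) : z]`, hence
`#H²(ℤ[1/p],T) ≤ [H¹(ℤ[1/p],T) : z]` by (14.14.2), (14.14.1)», as a DIVISIBILITY, in rank one, for any descent package `J` RECEIVING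
`X₀` injectively with finite cokernel (the shape delivered by `Kato2004.exists_iwasawaH2Data_fineSelmerDual_embedding`).

WHAT.
* §1 (pure `Λ`-module algebra) `natCard_invariants_eq_natCard_coinvariants_of_finite` — `#Q[T] = #Q/TQ` for a FINITE `Λ`-module
  (tree `nat_card_torsionBy_eq_nat_card_quotient_of_finite` at `x = T`); `natCard_coinvariants_mul_invariants_eq_of_injective_of_finite_quotient`
  — HERBRAND TRANSFER: for an injective `Λ`-linear `e : X → H` with `H / e(X)` finite and `X[T]`, `X/TX` finite: `H[T]`, `H/TH` are finite
  and `#(H/TH) · #X[T] = #H[T] · #(X/TX)` (tree `card_invariants_coinvariants_of_exact` on `0 → X → H → H/e(X) → 0`).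
* §2 `natCard_coinvariants_H2_dvd_index_of_rankOne` — rank one, `Ш[p^∞]` finite, `(κ, γ)` cyclotomic, `I` pinned, `J` a descent
  package, `Y` a dual fine Selmer datum with `e : Y.X ↪ J.H2` of finite cokernel, `Y.X` torsion, `proj₀ s` of infinite order,
  `char_Λ(𝐇¹_Γ/Λs) ⊆ char_Λ Y.X` ⟹ `(𝐇²_Γ)_Γ = J.H2/T` is finite and **`#(J.H2/T) ∣ [A : ℤ_p s₀]`**;
  `…_of_lengthAt_le_of_rankOne` — the same on the constructed datum `W.fineSelmerDualData κ hγ` from the LENGTH inequality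
  `ℓ_𝔭(X₀) ≤ ℓ_𝔭(𝐇¹_Γ/Λs)` (all height-one `𝔭`; the conclusion shape of the typed F1′
  `Kato2004.lengthAt_fineSelmerDual_le_of_isAdmissibleZetaClass`, HOME-staged 9021603a300e12fa) — torsion and `charIdeal` derived as in P1;
  `exists_natCard_coinvariants_H2_dvd_index_of_lengthAt_le_of_rankOne_of_embedding_fact` — with H2X as a binder: SOME package `J` with
  `#(J.H2/T) ∣ [A : ℤ_p s₀]`.

References: [Kato2004Asterisque] §14.14 with (14.14.1)–(14.14.2) and Lemma 14.15 (pp. 243–244), (14.9.1)–(14.9.3) (pp. 239–240),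
Thm. 12.5 (4) (p. 222); [GreenbergLNM1716] §4 Lemma 4.2 (p. 102); [Washington1997] §13.2.
-/

noncomputable section

set_option linter.dupNamespace false

open scoped NumberField
open Field IsDedekindDomain WeierstrassCurve
open Literature.NumberTheory.GaloisRepresentations Literature.NumberTheory.EllipticCurves
open Literature.NumberTheory.EllipticCurves.GreenbergSelmer
open Literature.NumberTheory.EllipticCurves.Kato2004 Literature.NumberTheory.EllipticCurves.Kato2004.EulerSystemValues
open Literature.NumberTheory.EllipticCurves.IwasawaAlgebra Literature.NumberTheory.EllipticCurves.IwasawaDual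
open Summit.BirchSwinnertonDyer.BirchSwinnertonDyer.Theorems.ErratumRoadFiveKatoFframeFineDescentRankOne

namespace Summit.BirchSwinnertonDyer.BirchSwinnertonDyer.Theorems.ErratumRoadFiveKatoFframeH2CoinvariantsIndex

/-! ## §1 Herbrand quotient of a finite `Λ`-module; transfer along an injection with finite cokernel -/

section Algebra

variable (p : ℕ) [Fact p.Prime]

/-- `#Q[T] = #(Q/TQ)` for a FINITE `Λ`-module `Q` (kernel and cokernel of multiplication by `T` on a finite group).
[cite: Washington1997, §13.2 (Herbrand-type count)] -/
theorem natCard_invariants_eq_natCard_coinvariants_of_finite (Q : Type*) [AddCommGroup Q]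
    [_root_.Module (IwasawaAlgebra p) Q] [Finite Q] :
    Nat.card (invariants p Q) = Nat.card (coinvariants p Q) :=
  nat_card_torsionBy_eq_nat_card_quotient_of_finite (PowerSeries.X : IwasawaAlgebra p)

/-- **Herbrand transfer along an injection with finite cokernel.** For an injective `Λ`-linear `e : X → H` with `H/e(X)`
finite and `X[T]`, `X/TX` finite: `H[T]` and `H/TH` are finite and `#(H/TH) · #X[T] = #H[T] · #(X/TX)` (multiplicativity of
the Herbrand quotient along `0 → X → H → H/e(X) → 0`, the finite quotient having Herbrand quotient `1`).
[cite: GreenbergLNM1716, §4 Lemma 4.2 (p. 102)] [cite: Washington1997, §13.2] -/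
theorem natCard_coinvariants_mul_invariants_eq_of_injective_of_finite_quotient {X H : Type*} [AddCommGroup X]
    [_root_.Module (IwasawaAlgebra p) X] [AddCommGroup H] [_root_.Module (IwasawaAlgebra p) H]
    (e : X →ₗ[IwasawaAlgebra p] H) (he : Function.Injective e) (hcok : Finite (H ⧸ LinearMap.range e))
    [Finite (invariants p X)] [Finite (coinvariants p X)] :
    Finite (invariants p H) ∧ Finite (coinvariants p H) ∧
      Nat.card (coinvariants p H) * Nat.card (invariants p X) =
        Nat.card (invariants p H) * Nat.card (coinvariants p X) := by
  haveI : Finite (coinvariants p (H ⧸ LinearMap.range e)) :=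
    Finite.of_surjective _ (Submodule.mkQ_surjective _)
  obtain ⟨hfi, hfc, hmul⟩ := card_invariants_coinvariants_of_exact e (LinearMap.range e).mkQ he
    (Submodule.mkQ_surjective _) (LinearMap.exact_map_mkQ_range e)
  refine ⟨hfi, hfc, ?_⟩
  have hpos : 0 < Nat.card (coinvariants p (H ⧸ LinearMap.range e)) := by
    haveI := hfc
    exact Nat.card_pos
  rw [natCard_invariants_eq_natCard_coinvariants_of_finite p (H ⧸ LinearMap.range e)] at hmul
  exact Nat.eq_of_mul_eq_mul_right hpos hmul

end Algebra

/-! ## §2 `#(𝐇²_Γ)_Γ ∣ [H¹(ℤ[1/p],T_pW) : ℤ_p s₀]` in rank one -/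

section Index

variable (W : WeierstrassCurve ℚ) [W.IsElliptic] (p : ℕ) [Fact p.Prime]
  [ContinuousSMul ℤ_[p] (W.tateModule p)] [Finite (AddCommGroup.primaryComponent W.sha p)]
  {κ : ZpExtension ℚ p} {γ : absoluteGaloisGroup ℚ}

/-- **[Ka] §14.14 in rank one: `#H²(ℤ[1/p],T_pW) ∣ [H¹(ℤ[1/p],T_pW) : ℤ_p s₀]`, tree currency.** For `rank W(ℚ) = 1`, `Ш(W)[p^∞]`
finite, the cyclotomic `(κ, γ)`, a pinned `I`, a descent package `J`, a dual fine Selmer datum `Y` with an INJECTIVE `Λ`-linear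
`e : Y.X → J.H2` of FINITE cokernel, `Y.X` torsion, `s ∈ 𝐇¹_Γ(T_pW)` with `proj₀ s` of infinite order and
`char_Λ(𝐇¹_Γ/Λs) ⊆ char_Λ Y.X`: `J.H2/T` is finite and `#(J.H2/T) ∣ [H¹(ℤ[1/p],T_pW) : ℤ_p s₀]`. Proof: P1 gives
`#(X/TX) · #𝐇²_Γ[T] ∣ #X[T] · [A : ℤ_p s₀]` (`X = Y.X`; `#𝐇²_Γ[T] = #desc` by `descentCokernelEquiv`; `#Sel₀^Γ = #(X/TX)`,
`#Sel₀_Γ = #X[T]` by the dual pair), the Herbrand transfer of §1 gives `#(𝐇²_Γ/T) · #X[T] = #𝐇²_Γ[T] · #(X/TX)`; cancel `#X[T] > 0`.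
[cite: Kato2004Asterisque, §14.14 (14.14.1)–(14.14.2) and Lemma 14.15 (pp. 243–244), Thm. 14.5 (3) (p. 236)]
[cite: GreenbergLNM1716, §4 Lemma 4.2 (p. 102)] -/
theorem natCard_coinvariants_H2_dvd_index_of_rankOne
    (hrank : W.mordellWeilRank = 1) (hκ : κ.IsCyclotomic) (hγ : κ.IsTopGenerator γ) (I : IwasawaH1Data W p κ γ)
    (J : IwasawaH2Data W p κ γ I) (Y : W.FineSelmerDualData κ γ) (e : Y.X →ₗ[IwasawaAlgebra p] J.H2)
    (he : Function.Injective e) (hcok : Finite (J.H2 ⧸ LinearMap.range e))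
    (hYtors : Module.IsTorsion (IwasawaAlgebra p) Y.X) (s : I.H) (hnt : ¬ IsOfFinAddOrder (I.proj 0 s))
    (hchar : Module.charIdeal (IwasawaAlgebra p) (I.H ⧸ Submodule.span (IwasawaAlgebra p) {s}) ≤
      Module.charIdeal (IwasawaAlgebra p) Y.X) :
    Finite (coinvariants p J.H2) ∧
      Nat.card (coinvariants p J.H2) ∣
        Nat.card (integralH1 (tateRep W p) p (κ.layerSubgroup 0) ⧸
          Submodule.span ℤ_[p] {(⟨I.proj 0 s, I.proj_mem 0 s⟩ : integralH1 (tateRep W p) p (κ.layerSubgroup 0))}) := by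
  obtain ⟨hfi, hfc, -, -, hdvd⟩ :=
    natCard_fineSelmer_invariants_mul_descentCokernel_dvd_of_charIdeal_le_of_rankOne W p hrank hκ hγ I Y hYtors s hnt hchar
  have hD := Y.isDualPair hγ
  haveI : Finite (invariants p Y.X) := hD.finite_invariants_iff.mpr hfc
  haveI : Finite (coinvariants p Y.X) := hD.finite_coinvariants_iff.mpr hfi
  obtain ⟨-, hfcH, hmul⟩ :=
    natCard_coinvariants_mul_invariants_eq_of_injective_of_finite_quotient p e he hcok
  refine ⟨hfcH, ?_⟩
  -- P1 in the `X[T]` / `X/TX` / `𝐇²_Γ[T]` currency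
  rw [← hD.natCard_coinvariants, ← hD.natCard_invariants, Nat.card_congr J.descentCokernelEquiv.toEquiv] at hdvd
  have hpos : 0 < Nat.card (invariants p Y.X) := Nat.card_pos
  have h : Nat.card (invariants p Y.X) * Nat.card (coinvariants p J.H2) ∣
      Nat.card (invariants p Y.X) *
        Nat.card (integralH1 (tateRep W p) p (κ.layerSubgroup 0) ⧸
          Submodule.span ℤ_[p] {(⟨I.proj 0 s, I.proj_mem 0 s⟩ : integralH1 (tateRep W p) p (κ.layerSubgroup 0))}) := by
    calc Nat.card (invariants p Y.X) * Nat.card (coinvariants p J.H2)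
        = Nat.card (coinvariants p Y.X) * Nat.card (invariants p J.H2) := by rw [mul_comm, hmul, mul_comm]
      _ ∣ _ := hdvd
  exact Nat.dvd_of_mul_dvd_mul_left hpos h

/-- **The same from the LENGTH inequality, on the constructed datum `X₀(W/ℚ_∞) = (W.fineSelmerDualData κ hγ).X`.** For rank
one, `Ш[p^∞]` finite, `(κ, γ)` cyclotomic, a pinned `I`, a package `J` receiving `X₀` injectively with finite cokernel,
`s ∈ 𝐇¹_Γ(T_pW)` with `proj₀ s` of infinite order and `ℓ_𝔭(X₀) ≤ ℓ_𝔭(𝐇¹_Γ/Λs)` at every height-one `𝔭` (for `s = z₀`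
admissible this is the conclusion of the named fact `Kato2004.lengthAt_fineSelmerDual_le_of_isAdmissibleZetaClass`, Thm. 12.5 (4)):
`#(J.H2/T) ∣ [H¹(ℤ[1/p],T_pW) : ℤ_p s₀]`. Torsion of `X₀` and the `charIdeal` divisibility are derived as in P1
(`Kim2025.charIdeal_le_charIdeal_of_lengthAt_le`). [cite: Kato2004Asterisque, Thm. 12.5 (4) (p. 222), §14.14 (pp. 243–244)] -/
theorem natCard_coinvariants_H2_dvd_index_of_lengthAt_le_of_rankOne
    (hrank : W.mordellWeilRank = 1) (hκ : κ.IsCyclotomic) (hγ : κ.IsTopGenerator γ) (I : IwasawaH1Data W p κ γ)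
    (J : IwasawaH2Data W p κ γ I) (e : (W.fineSelmerDualData κ hγ).X →ₗ[IwasawaAlgebra p] J.H2)
    (he : Function.Injective e) (hcok : Finite (J.H2 ⧸ LinearMap.range e))
    (s : I.H) (hnt : ¬ IsOfFinAddOrder (I.proj 0 s))
    (hlen : ∀ 𝔭 : PrimeSpectrum (IwasawaAlgebra p), 𝔭.asIdeal.height = 1 →
      Module.lengthAt (IwasawaAlgebra p) (W.fineSelmerDualData κ hγ).X 𝔭 ≤
        Module.lengthAt (IwasawaAlgebra p) (I.H ⧸ Submodule.span (IwasawaAlgebra p) {s}) 𝔭) :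
    Finite (coinvariants p J.H2) ∧
      Nat.card (coinvariants p J.H2) ∣
        Nat.card (integralH1 (tateRep W p) p (κ.layerSubgroup 0) ⧸
          Submodule.span ℤ_[p] {(⟨I.proj 0 s, I.proj_mem 0 s⟩ : integralH1 (tateRep W p) p (κ.layerSubgroup 0))}) := by
  have hs0 : s ≠ 0 := by
    rintro rfl
    exact hnt (by rw [map_zero]; exact isOfFinAddOrder_iff_nsmul_eq_zero.mpr ⟨1, one_pos, by simp⟩)
  haveI : Module.Finite (IwasawaAlgebra p) I.H := IwasawaH1Data.module_finite_of_isCyclotomic hκ hγ I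
  haveI := I.noZeroSMulDivisors hγ
  have htors : Module.IsTorsion (IwasawaAlgebra p) (I.H ⧸ Submodule.span (IwasawaAlgebra p) {s}) :=
    isTorsion_quotient_span_singleton_of_rankOne hrank hκ hγ I hs0
  haveI : Module.Finite (IwasawaAlgebra p) (W.fineSelmerDualData κ hγ).X :=
    FineSelmerDualData.module_finite W κ hγ _
  have hH : Module.lengthAt (IwasawaAlgebra p) (I.H ⧸ Submodule.span (IwasawaAlgebra p) {s}) (primeT p) ≠ ⊤ :=
    lengthAt_primeT_ne_top _ htors
  have hYtors : Module.IsTorsion (IwasawaAlgebra p) (W.fineSelmerDualData κ hγ).X :=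
    IwasawaAlgebra.isTorsion_of_lengthAt_primeT_ne_top _
      (ne_top_of_le_ne_top hH (hlen (primeT p) (height_primeT p)))
  have hchar : Module.charIdeal (IwasawaAlgebra p) (I.H ⧸ Submodule.span (IwasawaAlgebra p) {s}) ≤
      Module.charIdeal (IwasawaAlgebra p) (W.fineSelmerDualData κ hγ).X :=
    Kim2025.charIdeal_le_charIdeal_of_lengthAt_le htors hYtors hlen
  exact natCard_coinvariants_H2_dvd_index_of_rankOne W p hrank hκ hγ I J _ e he hcok hYtors s hnt hchar

/-- **With the comparison FACT H2X as a binder: SOME descent package has `#(J.H2/T) ∣ [H¹(ℤ[1/p],T_pW) : ℤ_p s₀]`.** For `p`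
odd, `κ` cyclotomic, `W(ℚ_{p,∞})[p^∞]` finite, rank one, `Ш[p^∞]` finite, a pinned `I`, `s` with `proj₀ s` of infinite order and
the length inequality: the package `J` delivered by `Kato2004.exists_iwasawaH2Data_fineSelmerDual_embedding` qualifies. (The S1Λ
consumer will rather take the package of the COUNT fact, which also carries `(e, he, hcok)`, and call the previous theorem.)
[cite: Kato2004Asterisque, (14.9.1) (p. 239), (17.13.1) (p. 279), §14.14 (pp. 243–244)] -/
theorem exists_natCard_coinvariants_H2_dvd_index_of_lengthAt_le_of_rankOne_of_embedding_fact
    (hX : exists_iwasawaH2Data_fineSelmerDual_embedding) (hp : p ≠ 2)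
    (hrank : W.mordellWeilRank = 1) (hκ : κ.IsCyclotomic) (hγ : κ.IsTopGenerator γ) (v : HeightOneSpectrum (𝓞 ℚ))
    (hv : ((Rat.HeightOneSpectrum.primesEquiv v : Nat.Primes) : ℕ) = p)
    (hfin : Finite (FixedPoints.addSubgroup ↥(κ.kerSubgroup ⊓ GreenbergSelmer.decomp v) (W.geomPrimaryTorsion p)))
    (I : IwasawaH1Data W p κ γ) (s : I.H) (hnt : ¬ IsOfFinAddOrder (I.proj 0 s))
    (hlen : ∀ 𝔭 : PrimeSpectrum (IwasawaAlgebra p), 𝔭.asIdeal.height = 1 →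
      Module.lengthAt (IwasawaAlgebra p) (W.fineSelmerDualData κ hγ).X 𝔭 ≤
        Module.lengthAt (IwasawaAlgebra p) (I.H ⧸ Submodule.span (IwasawaAlgebra p) {s}) 𝔭) :
    ∃ J : IwasawaH2Data W p κ γ I, Finite (coinvariants p J.H2) ∧
      Nat.card (coinvariants p J.H2) ∣
        Nat.card (integralH1 (tateRep W p) p (κ.layerSubgroup 0) ⧸
          Submodule.span ℤ_[p] {(⟨I.proj 0 s, I.proj_mem 0 s⟩ : integralH1 (tateRep W p) p (κ.layerSubgroup 0))}) := by
  obtain ⟨J, e, he, hcok⟩ := hX W p κ γ hγ v hp hκ hv hfin I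
  exact ⟨J, natCard_coinvariants_H2_dvd_index_of_lengthAt_le_of_rankOne W p hrank hκ hγ I J e he hcok s hnt hlen⟩

end Index

end Summit.BirchSwinnertonDyer.BirchSwinnertonDyer.Theorems.ErratumRoadFiveKatoFframeH2CoinvariantsIndex

end
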